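import Literature.NumberTheory.CubicFields.DeloneFaddeevAutomorphisms
import Literature.NumberTheory.CubicFields.ReducibleMaximality
import Literature.NumberTheory.QuadraticFields.FundamentalDiscriminant
import HarnessLib

/-!
# `|Aut(ℤ × 𝓞_F)| = 2`: the stabilizer of a maximal reducible form `(0, 1, c, d)` (BTT (29))

Topic `Literature/NumberTheory/CubicFields`; built on `DeloneFaddeevAutomorphisms.lean`
(`Stab_{GL₂(ℤ)}(f) ≅ Aut R(f)`, the twisted action of `GL (Fin 2) ℤ`) and
`ReducibleMaximality.lean` (maximal reducible rings are the `R((0,1,c,d))` with `c² − 4d`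
fundamental or `1`).

Bhargava–Taniguchi–Thorne 2023, §4.1 (29): "`|Aut(F)| = 2` if `F = F₂ × ℚ` with `F₂` a quadratic
field" (and `6` for `ℚ × ℚ × ℚ`), the automorphism group of the étale algebra being that of its
maximal order `ℤ × 𝓞_{F₂}`. Here, for the form `f = (0, 1, c, d) = v(u² + cuv + dv²)` whose ring is
`ℤ × ℤ[t]/(t² + ct + d)` (`ReducibleCubicRings.prodQuadEquiv`):

* `stabilizer_reducibleNormalForm_eq` — if `c² − 4d` is not a perfect square then
  **`Stab_{GL₂(ℤ)}(f) = {1, σ}`** with the involution `σ = (1 0; c −1)` (`u ↦ u + cv`, `v ↦ −v`: the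
  conjugation of the quadratic factor);
* `card_stabilizer_reducibleNormalForm` — **`|Stab(f)| = 2`**, hence
  `card_ringAut_reducibleNormalForm` — **`|Aut R(f)| = |Aut(ℤ × ℤ[t]/(t²+ct+d))| = 2`**;
* `not_isSquare_of_isFundamental`, `card_ringAut_eq_two_of_isFundamental` — in particular for every
  fundamental discriminant `c² − 4d`, i.e. **`|Aut(ℤ × 𝓞_F)| = 2`** for every quadratic field `F`.

NOT here: the case `c² − 4d = 1` (`ℤ³`, `|Aut| = 6`).

## References

* M. Bhargava, T. Taniguchi, F. Thorne, *Improved error estimates for the Davenport–Heilbronn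
  theorems*, Math. Ann. 389 (2024) = arXiv:2107.12819, §4.1 (29) [BhargavaTaniguchiThorne2023].
-/

namespace Literature.NumberTheory.CubicFields

open BinaryCubic RingOfForm Literature.NumberTheory.QuadraticFields

/-! ### The involution `σ = (1 0; c −1)` -/

/-- The involution `σ_c = (1 0; c −1)` of `GL₂(ℤ)`: `(u, v) ↦ (u + cv, −v)`. [folklore] -/
def sigma (c : ℤ) : GL (Fin 2) ℤ where
  val := !![1, 0; c, -1]
  inv := !![1, 0; c, -1]
  val_inv := by
    ext i j; fin_cases i <;> fin_cases j <;> simp [Matrix.mul_apply, Fin.sum_univ_two]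
  inv_val := by
    ext i j; fin_cases i <;> fin_cases j <;> simp [Matrix.mul_apply, Fin.sum_univ_two]

/-- The matrix of `σ_c`. [folklore] -/
@[simp] theorem coe_sigma (c : ℤ) : ((sigma c : GL (Fin 2) ℤ) : Matrix (Fin 2) (Fin 2) ℤ) = !![1, 0; c, -1] := rfl

/-- `σ_c ≠ 1`. [folklore] -/
theorem sigma_ne_one (c : ℤ) : sigma c ≠ 1 := by
  intro h
  have := congrArg (fun γ : GL (Fin 2) ℤ => (γ : Matrix (Fin 2) (Fin 2) ℤ) 1 1) h
  simp at this

/-- **`σ_c` stabilizes `(0, 1, c, d)`** (it is the conjugation `t ↦ −c − t` of the quadratic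
factor). [folklore] -/
theorem sigma_mem_stabilizer (c d : ℤ) :
    sigma c ∈ MulAction.stabilizer (GL (Fin 2) ℤ) (⟨0, 1, c, d⟩ : BinaryCubic ℤ) := by
  rw [mem_stabilizer_iff_twist, coe_sigma]
  ext <;> simp [twist, subst, Matrix.det_fin_two_of] <;> ring

/-! ### The stabilizer of `(0, 1, c, d)` -/

/-- A rational zero of `u² + cuv + dv²` makes `c² − 4d` a perfect square: if `p² + cpq + dq² = 0`
with `q ≠ 0` then `c² − 4d = ((2p + cq)/q)²` is the square of an integer. [folklore] -/
theorem isSquare_of_quadratic_zero {c d p q : ℤ} (hq : q ≠ 0) (h : p ^ 2 + c * p * q + d * q ^ 2 = 0) :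
    IsSquare (c ^ 2 - 4 * d) := by
  -- `(2p + cq)² = (c² − 4d) q²`
  have key : (2 * p + c * q) ^ 2 = (c ^ 2 - 4 * d) * q ^ 2 := by linear_combination 4 * h
  -- reduce the fraction `(2p + cq)/q`
  set a := 2 * p + c * q with ha
  set g := Int.gcd a q with hg
  have hg0 : (g : ℤ) ≠ 0 := by rw [hg]; exact_mod_cast Int.gcd_ne_zero_right hq
  obtain ⟨a₁, ha₁⟩ : (g : ℤ) ∣ a := hg ▸ Int.gcd_dvd_left a q
  obtain ⟨q₁, hq₁⟩ : (g : ℤ) ∣ q := hg ▸ Int.gcd_dvd_right a q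
  have hcop : IsCoprime a₁ q₁ := by
    rw [Int.isCoprime_iff_gcd_eq_one]
    have h1 := Int.gcd_div_gcd_div_gcd (i := a) (j := q) (Int.gcd_pos_of_ne_zero_right a hq)
    rw [← hg] at h1
    have hau : a / g = a₁ := by rw [ha₁]; exact Int.mul_ediv_cancel_left a₁ hg0
    have hqu : q / g = q₁ := by rw [hq₁]; exact Int.mul_ediv_cancel_left q₁ hg0
    rwa [hau, hqu] at h1
  have hq₁0 : q₁ ≠ 0 := by rintro rfl; rw [mul_zero] at hq₁; exact hq hq₁
  have key₁ : a₁ ^ 2 = (c ^ 2 - 4 * d) * q₁ ^ 2 := by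
    have h2 : (g : ℤ) ^ 2 * a₁ ^ 2 = (g : ℤ) ^ 2 * ((c ^ 2 - 4 * d) * q₁ ^ 2) := by
      rw [ha₁, hq₁] at key; linear_combination key
    exact mul_left_cancel₀ (pow_ne_zero 2 hg0) h2
  -- `q₁² ∣ a₁²` with `(a₁, q₁) = 1` forces `q₁ = ±1`
  have hunit : IsUnit (q₁ ^ 2) :=
    (IsCoprime.pow hcop).isUnit_of_dvd' ⟨c ^ 2 - 4 * d, by rw [key₁]; ring⟩ (dvd_refl _)
  have hq1 : q₁ ^ 2 = 1 := by
    rcases Int.isUnit_iff.mp hunit with h1 | h1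
    · exact h1
    · nlinarith [sq_nonneg q₁]
  exact ⟨a₁, by rw [← sq, key₁, hq1, mul_one]⟩

/-- **The stabilizer of `(0, 1, c, d)` is `{1, σ_c}`** when `c² − 4d` is not a perfect square: a
stabilizing `γ = (p q; r s)` must fix the rational root line `v = 0` (`q = 0`, else
`q(p² + cpq + dq²) = 0` gives a rational zero of the quadratic factor), and then the four
coefficient equations force `p = 1` and `(s, r) = (1, 0)` or `(−1, c)`. [folklore] -/
theorem stabilizer_reducibleNormalForm_eq {c d : ℤ} (hD : ¬ IsSquare (c ^ 2 - 4 * d)) :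
    (MulAction.stabilizer (GL (Fin 2) ℤ) (⟨0, 1, c, d⟩ : BinaryCubic ℤ) : Set (GL (Fin 2) ℤ)) = {1, sigma c} := by
  ext γ
  simp only [SetLike.mem_coe, Set.mem_insert_iff, Set.mem_singleton_iff]
  constructor
  · intro hγ
    rw [mem_stabilizer_iff_twist] at hγ
    set M : Matrix (Fin 2) (Fin 2) ℤ := (γ : Matrix (Fin 2) (Fin 2) ℤ) with hM
    have hdet : IsUnit M.det := Matrix.isUnits_det_units γ
    rw [Matrix.det_fin_two] at hdet
    -- the four coefficient equations of `twist M f = f`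
    have ha := congrArg BinaryCubic.a hγ
    have hb := congrArg BinaryCubic.b hγ
    have hc := congrArg BinaryCubic.c hγ
    simp only [twist, subst, smul_a, smul_b, smul_c, Matrix.det_fin_two] at ha hb hc
    -- Step 1: `M 0 1 = 0` (else the quadratic factor has a rational zero)
    have hq0 : M 0 1 = 0 := by
      by_contra hq
      apply hD
      have hD0 : M 0 0 * M 1 1 - M 0 1 * M 1 0 ≠ 0 := hdet.ne_zero
      have hprod : (M 0 0 * M 1 1 - M 0 1 * M 1 0) * (M 0 1 * (M 0 0 ^ 2 + c * M 0 0 * M 0 1 + d * M 0 1 ^ 2)) = 0 := by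
        linear_combination ha
      have hzero : M 0 0 ^ 2 + c * M 0 0 * M 0 1 + d * M 0 1 ^ 2 = 0 :=
        (mul_eq_zero.mp ((mul_eq_zero.mp hprod).resolve_left hD0)).resolve_left hq
      exact isSquare_of_quadratic_zero hq hzero
    rw [hq0] at hdet hb hc
    simp only [zero_mul, sub_zero] at hdet
    -- Step 2: `M 0 0 = 1`, `M 1 1 = ±1`
    have hs : M 1 1 = 1 ∨ M 1 1 = -1 := Int.isUnit_iff.mp (isUnit_of_mul_isUnit_right hdet)
    have hp : M 0 0 = 1 ∨ M 0 0 = -1 := Int.isUnit_iff.mp (isUnit_of_mul_isUnit_left hdet)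
    have hs2 : M 1 1 ^ 2 = 1 := by rcases hs with h | h <;> rw [h] <;> norm_num
    have e1 : M 0 0 ^ 3 * M 1 1 ^ 2 = 1 := by linear_combination hb
    have hp1 : M 0 0 = 1 := by
      rcases hp with h | h
      · exact h
      · rw [h, hs2] at e1; norm_num at e1
    rw [hp1] at hc
    -- Step 3: `2 M₁₀ + c M₁₁ = c`
    have e2 : 2 * M 1 0 + c * M 1 1 = c := by linear_combination hc - (2 * M 1 0 + c * M 1 1) * hs2
    -- Step 4: the two solutions
    rcases hs with h1 | h1
    · left
      have hr : M 1 0 = 0 := by rw [h1] at e2; linarith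
      apply Units.ext
      ext i j
      fin_cases i <;> fin_cases j <;> simp [← hM, hp1, hq0, hr, h1]
    · right
      have hr : M 1 0 = c := by rw [h1] at e2; linarith
      apply Units.ext
      ext i j
      fin_cases i <;> fin_cases j <;> simp [← hM, hp1, hq0, hr, h1]
  · rintro (rfl | rfl)
    · exact (MulAction.stabilizer (GL (Fin 2) ℤ) _).one_mem
    · exact sigma_mem_stabilizer c d

/-- **`|Stab_{GL₂(ℤ)}(0, 1, c, d)| = 2`** when `c² − 4d` is not a perfect square. [folklore] -/
theorem card_stabilizer_reducibleNormalForm {c d : ℤ} (hD : ¬ IsSquare (c ^ 2 - 4 * d)) :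
    Nat.card (MulAction.stabilizer (GL (Fin 2) ℤ) (⟨0, 1, c, d⟩ : BinaryCubic ℤ)) = 2 := by
  rw [Nat.card_eq_two_iff]
  refine ⟨⟨1, (MulAction.stabilizer (GL (Fin 2) ℤ) _).one_mem⟩, ⟨sigma c, sigma_mem_stabilizer c d⟩,
    fun h => sigma_ne_one c (congrArg Subtype.val h).symm, ?_⟩
  ext ⟨γ, hγ⟩
  simp only [Set.mem_insert_iff, Set.mem_singleton_iff, Set.mem_univ, iff_true]
  have hγ' : γ ∈ ((MulAction.stabilizer (GL (Fin 2) ℤ) (⟨0, 1, c, d⟩ : BinaryCubic ℤ)) : Set (GL (Fin 2) ℤ)) := hγ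
  rw [stabilizer_reducibleNormalForm_eq hD] at hγ'
  rcases hγ' with h | h
  · left; exact Subtype.ext h
  · right; exact Subtype.ext h

/-- **`|Aut R((0, 1, c, d))| = |Aut(ℤ × ℤ[t]/(t² + ct + d))| = 2`** when `c² − 4d` is not a perfect
square (Levi–Delone–Faddeev `Stab ≅ Aut`). [folklore] -/
theorem card_ringAut_reducibleNormalForm {c d : ℤ} (hD : ¬ IsSquare (c ^ 2 - 4 * d)) :
    Nat.card (RingAut (RingOfForm (⟨0, 1, c, d⟩ : BinaryCubic ℤ))) = 2 := by
  rw [← card_stabilizer_eq_card_ringAut, card_stabilizer_reducibleNormalForm hD]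

/-! ### Fundamental discriminants: `|Aut(ℤ × 𝓞_F)| = 2` -/

/-- A fundamental discriminant is not a perfect square (a square dividing it is `1` or `4`, and
neither `1` nor `4` is fundamental). [folklore] -/
theorem not_isSquare_of_isFundamental {D : ℤ}
    (hD : (D % 4 = 1 ∧ Squarefree D ∧ D ≠ 1) ∨ (4 ∣ D ∧ (D / 4 % 4 = 2 ∨ D / 4 % 4 = 3) ∧ Squarefree (D / 4))) :
    ¬ IsSquare D := by
  rintro ⟨x, hx⟩
  rw [← sq] at hx
  rcases Quadratic.sq_eq_one_or_four_of_sq_dvd hD ⟨1, by rw [hx, mul_one]⟩ with h | h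
  · rw [h] at hx
    rcases hD with ⟨-, -, hne⟩ | ⟨h4, -, -⟩
    · exact hne hx
    · rw [hx] at h4; norm_num at h4
  · rw [h] at hx
    rcases hD with ⟨hm, -, -⟩ | ⟨-, hm, -⟩
    · rw [hx] at hm; norm_num at hm
    · rw [hx] at hm; norm_num at hm

/-- **`|Aut(ℤ × 𝓞_F)| = 2` for every quadratic field `F`** (BTT 2023, §4.1 (29): "`|Aut(F)| = 2` if
`F = F₂ × ℚ` with `F₂` a quadratic field"): for every fundamental discriminant `c² − 4d`, the maximal
reducible cubic ring `R((0,1,c,d)) ≅ ℤ × 𝓞_{ℚ(√(c²−4d))}` has exactly two automorphisms. [cite: BhargavaTaniguchiThorne2023, §4.1 (29) (|Aut(F₂ × ℚ)| = 2)] -/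
theorem card_ringAut_eq_two_of_isFundamental {c d : ℤ}
    (hD : ((c ^ 2 - 4 * d) % 4 = 1 ∧ Squarefree (c ^ 2 - 4 * d) ∧ c ^ 2 - 4 * d ≠ 1) ∨
      (4 ∣ c ^ 2 - 4 * d ∧ ((c ^ 2 - 4 * d) / 4 % 4 = 2 ∨ (c ^ 2 - 4 * d) / 4 % 4 = 3) ∧ Squarefree ((c ^ 2 - 4 * d) / 4))) :
    Nat.card (RingAut (RingOfForm (⟨0, 1, c, d⟩ : BinaryCubic ℤ))) = 2 :=
  card_ringAut_reducibleNormalForm (not_isSquare_of_isFundamental hD)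

/-- The same for the stabilizer: `|Stab(f)| = 2` for the maximal reducible forms of fundamental
discriminant, i.e. the Shintani weight of these orbits is `1/2`. [folklore] -/
theorem card_stabilizer_eq_two_of_isFundamental {c d : ℤ}
    (hD : ((c ^ 2 - 4 * d) % 4 = 1 ∧ Squarefree (c ^ 2 - 4 * d) ∧ c ^ 2 - 4 * d ≠ 1) ∨
      (4 ∣ c ^ 2 - 4 * d ∧ ((c ^ 2 - 4 * d) / 4 % 4 = 2 ∨ (c ^ 2 - 4 * d) / 4 % 4 = 3) ∧ Squarefree ((c ^ 2 - 4 * d) / 4))) :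
    Nat.card (MulAction.stabilizer (GL (Fin 2) ℤ) (⟨0, 1, c, d⟩ : BinaryCubic ℤ)) = 2 :=
  card_stabilizer_reducibleNormalForm (not_isSquare_of_isFundamental hD)

end Literature.NumberTheory.CubicFields
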